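/-
Copyright: the b2b-balaban T⁴-continuum CRUX team, row NE7b OWNER lineage `t4-ne7b-p1` (gen 109). Project licence.
-/
import Mathlib.Analysis.Convex.Strong
import Mathlib.Analysis.InnerProductSpace.Adjoint

/-!
# THE MODULUS LETTER ALONG THE FLOW: restriction, translation, linear change of variables (rescaling!) and sums — bookkeeping for
# family (2)'s letter (ℓ1) «`V` is `λ`-uniformly convex ON `K`» in both currencies, Mathlib's `StrongConvexOn` and the road's first-order
# letter (row NE7b, node U5c; residual (R2′) family (2); companion of `…LogConcaveMarginal`)

Cell `pub-balaban`, sub-cell `t4`, spine estimate NE7b (`T4WeightBudget.RelWeightBound`; the cell's OWN estimate — NOT PRINTED in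
[Bałaban 1983–89], NOT PROVED).  Crux-route work under `Spine/NE7b/` by the row's OWNER; NOTHING of Bałaban's is named or asserted;
no `T4Continuum/Support` leaf typed; no `def`; zero `sorry`.  Mathlib only.

WHY.  Between two sockets of the windowed convexity road the exponent is (i) integrated over fluctuation variables
(`…LogConcaveMarginal`: the modulus in the kept variables survives), (ii) RESTRICTED to a smaller window (new small-field conditions),
(iii) RE-EXPRESSED in the next scale's variables — a translation to the new background and a LINEAR CHANGE OF VARIABLES (print's rescaling
`ψ ↦ L^{α}ψ(L·)`, block maps, charts of the constrained subspace), and (iv) AUGMENTED by new convex terms.  Each operation acts on the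
letter (ℓ1) by an explicit rule; this file is those rules, so that an (A3) instance carries ONE number `λ` through the step by
arithmetic: restriction keeps `λ`; translation keeps `λ`; a linear map `T` bounded below by `μ` (`μ‖x‖ ≤ ‖T x‖`: isometries `μ = 1`,
the homothety `x ↦ c x` with `μ = |c|`) turns `λ` into `μ²λ`; adding a convex term keeps `λ`, adding a `λ'`-convex term gives `λ + λ'`.

WHAT IS PROVED ([folklore]; Mathlib's `UniformConvexOn`, `Convex.linear_preimage`, `ContinuousLinearMap.adjoint_inner_left` BY NAME):
* §1 `StrongConvexOn` currency: **`strongConvexOn_subset`** (restriction to a convex sub-window), **`strongConvexOn_comp_add_right`**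
  (translation `x ↦ V (x + v)` on the translated window), **`strongConvexOn_comp_linearMap_of_bound_below`** (`T` linear with `μ‖x‖ ≤ ‖T x‖`,
  `0 ≤ λ` ⟹ `V ∘ T` is `μ²λ`-strongly convex on `T ⁻¹' K`; corollaries `…_comp_linearIsometry` (`λ` kept) and `…_comp_smul` (homothety:
  `c²λ`)), **`strongConvexOn_add_convexOn`** ∕ **`strongConvexOn_add`** (moduli `λ + 0` ∕ `λ + λ'`).
* §2 the road's FIRST-ORDER currency `V x + ⟪dV x, y − x⟫ + (λ∕2)‖y − x‖² ≤ V y` ON `K` (any vector field `dV`): **`firstOrderOn_subset`**,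
  **`firstOrderOn_comp_add_right`** (field `x ↦ dV (x + v)`), **`firstOrderOn_comp_clm_of_bound_below`** (field `x ↦ T†(dV (T x))` — the
  ADJOINT carries the gradient back; modulus `μ²λ`), **`firstOrderOn_add`** (fields add, moduli add).

NOT HERE (honest): which maps print's steps apply (the rescaling exponents, the block-averaging charts, the background translation — (A3)
readings); the marginal step (`…LogConcaveMarginal`); anything of Bałaban's.  BY-NAME EFFECT ON THE WALL: NONE (bookkeeping of a letter).
NE7b NOT PRINTED ∕ NOT PROVED; spine PROVED 0∕9; rung (B)+1 on a FINITE torus — NOT infinite volume, NOT the mass gap, NOT Clay.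
HONEST DEPENDENCY: continuum YM on T⁴ ⇐ BetaPertH ∧ nine spine estimates (0/9 proved); BetaPertH ⇐ (D1) ∧ (D4) ∧ CAP+tail.
-/

set_option autoImplicit false

open Set
open scoped RealInnerProductSpace

namespace Summit.QuantumFields.BalabanUV.T4Continuum.NE7b.ConvexityModulusTransport

/-! ## §1 The `StrongConvexOn` currency -/

section Strong

variable {E F : Type*} [NormedAddCommGroup E] [InnerProductSpace ℝ E] [NormedAddCommGroup F] [InnerProductSpace ℝ F]

/-- **RESTRICTION**: a `λ`-strongly convex function on `K` is `λ`-strongly convex on every convex `K' ⊆ K`. [folklore] -/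
theorem strongConvexOn_subset {K K' : Set E} {lam : ℝ} {V : E → ℝ} (h : StrongConvexOn K lam V) (hK' : K' ⊆ K)
    (hc : Convex ℝ K') : StrongConvexOn K' lam V :=
  ⟨hc, fun _ hx _ hy _ _ ha hb hab => h.2 (hK' hx) (hK' hy) ha hb hab⟩

/-- **TRANSLATION**: `x ↦ V (x + v)` is `λ`-strongly convex on the translated window `{x : x + v ∈ K}`. [folklore] -/
theorem strongConvexOn_comp_add_right {K : Set E} {lam : ℝ} {V : E → ℝ} (h : StrongConvexOn K lam V) (v : E) :
    StrongConvexOn ((fun x => x + v) ⁻¹' K) lam fun x => V (x + v) := by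
  refine ⟨h.1.translate_preimage_left v, ?_⟩
  intro x hx y hy a b ha hb hab
  have key := h.2 hx hy ha hb hab
  have e : a • (x + v) + b • (y + v) = a • x + b • y + v := by
    calc a • (x + v) + b • (y + v) = a • x + b • y + (a + b) • v := by rw [add_smul, smul_add, smul_add]; abel
      _ = a • x + b • y + v := by rw [hab, one_smul]
  rw [e, show x + v - (y + v) = x - y by abel] at key
  exact key

/-- **LINEAR CHANGE OF VARIABLES, BOUNDED BELOW**: if `T : F →ₗ[ℝ] E` satisfies `μ‖x‖ ≤ ‖T x‖` (`μ ≥ 0`) and `V` is `λ`-strongly convex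
on `K` with `λ ≥ 0`, then `V ∘ T` is `μ²λ`-strongly convex on `T ⁻¹' K` (print's rescaling between scales; charts of a constrained
subspace; isometries `μ = 1`). [folklore] -/
theorem strongConvexOn_comp_linearMap_of_bound_below {K : Set E} {lam mu : ℝ} {V : E → ℝ} (h : StrongConvexOn K lam V)
    (hlam : 0 ≤ lam) (T : F →ₗ[ℝ] E) (hmu : 0 ≤ mu) (hT : ∀ x, mu * ‖x‖ ≤ ‖T x‖) :
    StrongConvexOn (T ⁻¹' K) (mu ^ 2 * lam) fun x => V (T x) := by
  refine ⟨h.1.linear_preimage T, ?_⟩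
  intro x hx y hy a b ha hb hab
  have key := h.2 hx hy ha hb hab
  simp only [map_add, map_smul, smul_eq_mul] at key ⊢
  have hn : mu ^ 2 * ‖x - y‖ ^ 2 ≤ ‖T x - T y‖ ^ 2 := by
    rw [← map_sub, ← mul_pow]
    exact pow_le_pow_left₀ (mul_nonneg hmu (norm_nonneg _)) (hT _) 2
  nlinarith [mul_nonneg (mul_nonneg ha hb) hlam, hn]

/-- Corollary: a LINEAR ISOMETRY keeps the modulus — `V ∘ e` is `λ`-strongly convex on `e ⁻¹' K` (`λ ≥ 0`). [folklore] -/
theorem strongConvexOn_comp_linearIsometry {K : Set E} {lam : ℝ} {V : E → ℝ} (h : StrongConvexOn K lam V) (hlam : 0 ≤ lam)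
    (e : F →ₗᵢ[ℝ] E) : StrongConvexOn (e ⁻¹' K) lam fun x => V (e x) := by
  have h1 := strongConvexOn_comp_linearMap_of_bound_below h hlam e.toLinearMap zero_le_one fun x => by
    rw [one_mul]; exact (e.norm_map x).ge
  simpa using h1

/-- Corollary: the HOMOTHETY `x ↦ c • x` (print's rescaling of the field) turns the modulus `λ ≥ 0` into `c²λ` on the rescaled window
`{x : c • x ∈ K}`. [folklore] -/
theorem strongConvexOn_comp_smul {K : Set E} {lam : ℝ} {V : E → ℝ} (h : StrongConvexOn K lam V) (hlam : 0 ≤ lam) (c : ℝ) :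
    StrongConvexOn ((fun x => c • x) ⁻¹' K) (c ^ 2 * lam) fun x => V (c • x) := by
  have h1 := strongConvexOn_comp_linearMap_of_bound_below h hlam (c • LinearMap.id : E →ₗ[ℝ] E) (abs_nonneg c) fun x => by
    rw [LinearMap.smul_apply, LinearMap.id_apply, norm_smul, Real.norm_eq_abs]
  have hK : ((c • LinearMap.id : E →ₗ[ℝ] E) : E → E) ⁻¹' K = (fun x => c • x) ⁻¹' K := by
    ext x; simp
  rw [hK, sq_abs] at h1
  simpa using h1

/-- **SUMS, I**: `λ`-strongly convex plus convex is `λ`-strongly convex. [folklore] -/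
theorem strongConvexOn_add_convexOn {K : Set E} {lam : ℝ} {V W : E → ℝ} (hV : StrongConvexOn K lam V) (hW : ConvexOn ℝ K W) :
    StrongConvexOn K lam (V + W) := by
  have h := UniformConvexOn.add hV hW.uniformConvexOn_zero
  refine ⟨h.1, fun x hx y hy a b ha hb hab => ?_⟩
  have key := h.2 hx hy ha hb hab
  simpa using key

/-- **SUMS, II**: the moduli add — `λ`-strongly convex plus `λ'`-strongly convex is `(λ + λ')`-strongly convex. [folklore] -/
theorem strongConvexOn_add {K : Set E} {lam lam' : ℝ} {V W : E → ℝ} (hV : StrongConvexOn K lam V) (hW : StrongConvexOn K lam' W) :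
    StrongConvexOn K (lam + lam') (V + W) := by
  have h := UniformConvexOn.add hV hW
  refine ⟨h.1, fun x hx y hy a b ha hb hab => ?_⟩
  have key := h.2 hx hy ha hb hab
  simp only [Pi.add_apply, smul_eq_mul] at key ⊢
  nlinarith [key]

end Strong

/-! ## §2 The road's first-order currency -/

section FirstOrder

variable {E F : Type*} [NormedAddCommGroup E] [InnerProductSpace ℝ E] [NormedAddCommGroup F] [InnerProductSpace ℝ F]

/-- **RESTRICTION** of the first-order letter to a sub-window. [folklore] -/
theorem firstOrderOn_subset {K K' : Set E} {lam : ℝ} {V : E → ℝ} {dV : E → E}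
    (h : ∀ x ∈ K, ∀ y ∈ K, V x + ⟪dV x, y - x⟫ + lam / 2 * ‖y - x‖ ^ 2 ≤ V y) (hK' : K' ⊆ K) :
    ∀ x ∈ K', ∀ y ∈ K', V x + ⟪dV x, y - x⟫ + lam / 2 * ‖y - x‖ ^ 2 ≤ V y :=
  fun x hx y hy => h x (hK' hx) y (hK' hy)

/-- **TRANSLATION**: the letter for `x ↦ V (x + v)` ON `{x : x + v ∈ K}` with the translated field `x ↦ dV (x + v)`. [folklore] -/
theorem firstOrderOn_comp_add_right {K : Set E} {lam : ℝ} {V : E → ℝ} {dV : E → E}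
    (h : ∀ x ∈ K, ∀ y ∈ K, V x + ⟪dV x, y - x⟫ + lam / 2 * ‖y - x‖ ^ 2 ≤ V y) (v : E) :
    ∀ x ∈ (fun x => x + v) ⁻¹' K, ∀ y ∈ (fun x => x + v) ⁻¹' K,
      V (x + v) + ⟪dV (x + v), y - x⟫ + lam / 2 * ‖y - x‖ ^ 2 ≤ V (y + v) := by
  intro x hx y hy
  have key := h (x + v) hx (y + v) hy
  rwa [show y + v - (x + v) = y - x by abel] at key

/-- **LINEAR CHANGE OF VARIABLES, BOUNDED BELOW, first-order currency**: for a continuous linear `T : F →L[ℝ] E` with `μ‖x‖ ≤ ‖T x‖`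
(`μ ≥ 0`) and the letter for `V` ON `K` with modulus `λ ≥ 0` and field `dV`, the pull-back `V ∘ T` obeys the letter ON `T ⁻¹' K` with
modulus `μ²λ` and the field `x ↦ T†(dV (T x))` — THE ADJOINT CARRIES THE GRADIENT BACK. [folklore] -/
theorem firstOrderOn_comp_clm_of_bound_below [CompleteSpace E] [CompleteSpace F] {K : Set E} {lam mu : ℝ} {V : E → ℝ}
    {dV : E → E} (h : ∀ x ∈ K, ∀ y ∈ K, V x + ⟪dV x, y - x⟫ + lam / 2 * ‖y - x‖ ^ 2 ≤ V y) (hlam : 0 ≤ lam)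
    (T : F →L[ℝ] E) (hmu : 0 ≤ mu) (hT : ∀ x, mu * ‖x‖ ≤ ‖T x‖) :
    ∀ x ∈ T ⁻¹' K, ∀ y ∈ T ⁻¹' K,
      V (T x) + ⟪ContinuousLinearMap.adjoint T (dV (T x)), y - x⟫ + mu ^ 2 * lam / 2 * ‖y - x‖ ^ 2 ≤ V (T y) := by
  intro x hx y hy
  have key := h (T x) hx (T y) hy
  rw [ContinuousLinearMap.adjoint_inner_left, map_sub]
  have hn : mu ^ 2 * ‖y - x‖ ^ 2 ≤ ‖T y - T x‖ ^ 2 := by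
    rw [← map_sub, ← mul_pow]
    exact pow_le_pow_left₀ (mul_nonneg hmu (norm_nonneg _)) (hT _) 2
  nlinarith [hn, hlam]

/-- Corollary: the HOMOTHETY `x ↦ c • x`, first-order currency — modulus `c²λ` (any sign of `λ`: an identity), field `x ↦ c • dV (c • x)`.
[folklore] -/
theorem firstOrderOn_comp_smul {K : Set E} {lam : ℝ} {V : E → ℝ} {dV : E → E}
    (h : ∀ x ∈ K, ∀ y ∈ K, V x + ⟪dV x, y - x⟫ + lam / 2 * ‖y - x‖ ^ 2 ≤ V y) (c : ℝ) :
    ∀ x ∈ (fun x => c • x) ⁻¹' K, ∀ y ∈ (fun x => c • x) ⁻¹' K,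
      V (c • x) + ⟪c • dV (c • x), y - x⟫ + c ^ 2 * lam / 2 * ‖y - x‖ ^ 2 ≤ V (c • y) := by
  intro x hx y hy
  have key := h (c • x) hx (c • y) hy
  rw [← smul_sub, norm_smul, mul_pow, Real.norm_eq_abs, sq_abs, inner_smul_right] at key
  rw [real_inner_smul_left]
  nlinarith [key]

/-- **SUMS**: the letters add — fields add, moduli add (take `λ' = 0` for a merely convex addition). [folklore] -/
theorem firstOrderOn_add {K : Set E} {lam lam' : ℝ} {V W : E → ℝ} {dV dW : E → E}
    (hV : ∀ x ∈ K, ∀ y ∈ K, V x + ⟪dV x, y - x⟫ + lam / 2 * ‖y - x‖ ^ 2 ≤ V y)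
    (hW : ∀ x ∈ K, ∀ y ∈ K, W x + ⟪dW x, y - x⟫ + lam' / 2 * ‖y - x‖ ^ 2 ≤ W y) :
    ∀ x ∈ K, ∀ y ∈ K, (V x + W x) + ⟪dV x + dW x, y - x⟫ + (lam + lam') / 2 * ‖y - x‖ ^ 2 ≤ V y + W y := by
  intro x hx y hy
  have h1 := hV x hx y hy
  have h2 := hW x hx y hy
  rw [inner_add_left]
  linarith

end FirstOrder

/-! ## §3 (appended gen 109, same seat): a 2-HOMOGENEOUS modulus functional `Q` in place of `(λ∕2)‖·‖²` (weighted seminorm ∕ per-block ∕ Schur forms —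
refuter κ-ne7bref-g77-1; companion of `…LogConcaveMarginal` §6): the first-order letter with `Q` gives the secant letter with `Q`. -/

section Form

variable {E : Type*} [NormedAddCommGroup E] [InnerProductSpace ℝ E]

/-- **FIRST-ORDER LETTER WITH A FORM ⟹ SECANT LETTER WITH THE FORM**: `Q` 2-homogeneous (`Q (t • v) = t² Q v`), and ON a convex `K`
`V x + ⟪dV x, y − x⟫ + Q (y − x) ≤ V y` (any vector field `dV`) ⟹ `V(a p + b q) + a·b·Q(q − p) ≤ a V(p) + b V(q)` for `p, q ∈ K`, `a, b ≥ 0`,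
`a + b = 1` (with `Q = (λ∕2)‖·‖²` this is `…LogConcaveMarginal.secant_of_firstOrderOn`). [folklore] -/
theorem secant_of_firstOrderOn_form {K : Set E} (hK : Convex ℝ K) {V : E → ℝ} {dV : E → E} (Q : E → ℝ)
    (hQ : ∀ (t : ℝ) (v : E), Q (t • v) = t ^ 2 * Q v)
    (h : ∀ x ∈ K, ∀ y ∈ K, V x + ⟪dV x, y - x⟫ + Q (y - x) ≤ V y)
    {p q : E} (hp : p ∈ K) (hq : q ∈ K) {a b : ℝ} (ha : 0 ≤ a) (hb : 0 ≤ b) (hab : a + b = 1) :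
    V (a • p + b • q) + a * b * Q (q - p) ≤ a * V p + b * V q := by
  have ha' : a = 1 - b := by linarith
  subst ha'
  have hz : (1 - b) • p + b • q ∈ K := hK hp hq ha hb hab
  have h1 := h _ hz p hp
  have h2 := h _ hz q hq
  have e1 : p - ((1 - b) • p + b • q) = (-b) • (q - p) := by
    simp only [sub_smul, one_smul, smul_sub, neg_smul]; abel
  have e2 : q - ((1 - b) • p + b • q) = (1 - b) • (q - p) := by
    simp only [sub_smul, one_smul, smul_sub]; abel
  rw [e1, inner_smul_right, hQ] at h1
  rw [e2, inner_smul_right, hQ] at h2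
  have hsum := add_le_add (mul_le_mul_of_nonneg_left h1 ha) (mul_le_mul_of_nonneg_left h2 hb)
  linear_combination hsum

end Form

/-! ## §4 (appended gen 109): TRANSPORT IN THE FORM CURRENCY — the secant letter with a base functional `Q`
(`V(a p + b q) + a·b·Q(q − p) ≤ a V p + b V q` on `K`; the conclusion currency of `…LogConcaveMarginal` §6) under restriction, translation,
ANY linear change of variables (EXACT: the form becomes `Q ∘ T` — no loss, unlike the scalar `μ²λ`), sums and weakening of the form. -/

section FormTransport

variable {E F : Type*} [AddCommGroup E] [Module ℝ E] [AddCommGroup F] [Module ℝ F]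

/-- **RESTRICTION** in the form currency. [folklore] -/
theorem secantForm_subset {K K' : Set E} {V Q : E → ℝ}
    (h : ∀ p ∈ K, ∀ q ∈ K, ∀ a b : ℝ, 0 ≤ a → 0 ≤ b → a + b = 1 → V (a • p + b • q) + a * b * Q (q - p) ≤ a * V p + b * V q)
    (hK' : K' ⊆ K) :
    ∀ p ∈ K', ∀ q ∈ K', ∀ a b : ℝ, 0 ≤ a → 0 ≤ b → a + b = 1 → V (a • p + b • q) + a * b * Q (q - p) ≤ a * V p + b * V q :=
  fun p hp q hq => h p (hK' hp) q (hK' hq)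

/-- **LINEAR CHANGE OF VARIABLES, EXACT** in the form currency: for ANY linear `T : F →ₗ[ℝ] E`, `V ∘ T` obeys the secant letter on `T ⁻¹' K`
with the pulled-back form `Q ∘ T` (block maps, rescalings, charts of a constrained subspace — no bound below needed, nothing lost). [folklore] -/
theorem secantForm_comp_linearMap {K : Set E} {V Q : E → ℝ}
    (h : ∀ p ∈ K, ∀ q ∈ K, ∀ a b : ℝ, 0 ≤ a → 0 ≤ b → a + b = 1 → V (a • p + b • q) + a * b * Q (q - p) ≤ a * V p + b * V q)
    (T : F →ₗ[ℝ] E) :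
    ∀ p ∈ T ⁻¹' K, ∀ q ∈ T ⁻¹' K, ∀ a b : ℝ, 0 ≤ a → 0 ≤ b → a + b = 1 →
      V (T (a • p + b • q)) + a * b * Q (T (q - p)) ≤ a * V (T p) + b * V (T q) := by
  intro p hp q hq a b ha hb hab
  have key := h (T p) hp (T q) hq a b ha hb hab
  rwa [← map_sub, ← T.map_smul, ← T.map_smul, ← map_add] at key

/-- **TRANSLATION** in the form currency: `x ↦ V (x + v)` obeys the letter on `{x : x + v ∈ K}` with the SAME form `Q`. [folklore] -/
theorem secantForm_comp_add_right {K : Set E} {V Q : E → ℝ}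
    (h : ∀ p ∈ K, ∀ q ∈ K, ∀ a b : ℝ, 0 ≤ a → 0 ≤ b → a + b = 1 → V (a • p + b • q) + a * b * Q (q - p) ≤ a * V p + b * V q)
    (v : E) :
    ∀ p ∈ (fun x => x + v) ⁻¹' K, ∀ q ∈ (fun x => x + v) ⁻¹' K, ∀ a b : ℝ, 0 ≤ a → 0 ≤ b → a + b = 1 →
      V (a • p + b • q + v) + a * b * Q (q - p) ≤ a * V (p + v) + b * V (q + v) := by
  intro p hp q hq a b ha hb hab
  have key := h (p + v) hp (q + v) hq a b ha hb hab
  have e : a • (p + v) + b • (q + v) = a • p + b • q + v := by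
    calc a • (p + v) + b • (q + v) = a • p + b • q + (a + b) • v := by rw [add_smul, smul_add, smul_add]; abel
      _ = a • p + b • q + v := by rw [hab, one_smul]
  rwa [e, show q + v - (p + v) = q - p by abel] at key

/-- **SUMS** in the form currency: the forms add. [folklore] -/
theorem secantForm_add {K : Set E} {V W Q R : E → ℝ}
    (hV : ∀ p ∈ K, ∀ q ∈ K, ∀ a b : ℝ, 0 ≤ a → 0 ≤ b → a + b = 1 → V (a • p + b • q) + a * b * Q (q - p) ≤ a * V p + b * V q)
    (hW : ∀ p ∈ K, ∀ q ∈ K, ∀ a b : ℝ, 0 ≤ a → 0 ≤ b → a + b = 1 → W (a • p + b • q) + a * b * R (q - p) ≤ a * W p + b * W q) :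
    ∀ p ∈ K, ∀ q ∈ K, ∀ a b : ℝ, 0 ≤ a → 0 ≤ b → a + b = 1 →
      (V (a • p + b • q) + W (a • p + b • q)) + a * b * (Q (q - p) + R (q - p)) ≤ a * (V p + W p) + b * (V q + W q) := by
  intro p hp q hq a b ha hb hab
  have h1 := hV p hp q hq a b ha hb hab
  have h2 := hW p hp q hq a b ha hb hab
  linarith

/-- **WEAKENING THE FORM**: any smaller functional `Q' ≤ Q` (pointwise) is also a modulus form. [folklore] -/
theorem secantForm_mono {K : Set E} {V Q Q' : E → ℝ} (hQ : ∀ v, Q' v ≤ Q v)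
    (h : ∀ p ∈ K, ∀ q ∈ K, ∀ a b : ℝ, 0 ≤ a → 0 ≤ b → a + b = 1 → V (a • p + b • q) + a * b * Q (q - p) ≤ a * V p + b * V q) :
    ∀ p ∈ K, ∀ q ∈ K, ∀ a b : ℝ, 0 ≤ a → 0 ≤ b → a + b = 1 → V (a • p + b • q) + a * b * Q' (q - p) ≤ a * V p + b * V q := by
  intro p hp q hq a b ha hb hab
  have key := h p hp q hq a b ha hb hab
  nlinarith [hQ (q - p), mul_nonneg ha hb]

end FormTransport

/-! ## §5 (appended gen 109): the FEEDER of `…LogConcaveMarginal` §6 — the joint first-order letter on a product with a SPLIT 2-homogeneous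
modulus `Q₁(q₁ − p₁) + Q₂(q₂ − p₂)` gives §6's base-form secant hypothesis with `Q₁` (the fibre share `Q₂ ≥ 0` dropped); located by chair
leaf-05 g146 (ι-X-CMT2-g146-1 ∕ OFFER ο-leaf05-g146-1): §3 lives on ONE inner product space, §6's hypothesis on the sup-norm product. -/

section ProdForm

variable {E₁ E₂ : Type*} [NormedAddCommGroup E₁] [InnerProductSpace ℝ E₁] [NormedAddCommGroup E₂] [InnerProductSpace ℝ E₂]

/-- **JOINT FIRST-ORDER LETTER WITH A SPLIT FORM ⟹ THE BASE-FORM SECANT LETTER** (feeder of `…LogConcaveMarginal.neg_log_fibreIntegral_secant_of_baseForm`):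
on a convex `K ⊆ E₁ × E₂`, `V p + ⟪d₁V p, q₁ − p₁⟫ + ⟪d₂V p, q₂ − p₂⟫ + Q₁(q₁ − p₁) + Q₂(q₂ − p₂) ≤ V q` with `Q₁, Q₂` 2-homogeneous and `Q₂ ≥ 0`
⟹ `V(a p + b q) + a·b·Q₁(q₁ − p₁) ≤ a V p + b V q`. [folklore] -/
theorem secant_base_of_firstOrderOn_prod_form {K : Set (E₁ × E₂)} (hK : Convex ℝ K) {V : E₁ × E₂ → ℝ} {dV₁ : E₁ × E₂ → E₁}
    {dV₂ : E₁ × E₂ → E₂} (Q₁ : E₁ → ℝ) (Q₂ : E₂ → ℝ) (hQ₁ : ∀ (t : ℝ) (v : E₁), Q₁ (t • v) = t ^ 2 * Q₁ v)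
    (hQ₂ : ∀ (t : ℝ) (v : E₂), Q₂ (t • v) = t ^ 2 * Q₂ v) (hQ₂0 : ∀ v, 0 ≤ Q₂ v)
    (h : ∀ p ∈ K, ∀ q ∈ K, V p + ⟪dV₁ p, q.1 - p.1⟫ + ⟪dV₂ p, q.2 - p.2⟫ + (Q₁ (q.1 - p.1) + Q₂ (q.2 - p.2)) ≤ V q) :
    ∀ p ∈ K, ∀ q ∈ K, ∀ a b : ℝ, 0 ≤ a → 0 ≤ b → a + b = 1 →
      V (a • p + b • q) + a * b * Q₁ (q.1 - p.1) ≤ a * V p + b * V q := by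
  intro p hp q hq a b ha hb hab
  have ha' : a = 1 - b := by linarith
  subst ha'
  have hz : (1 - b) • p + b • q ∈ K := hK hp hq ha hb hab
  have h1 := h _ hz p hp
  have h2 := h _ hz q hq
  have e11 : p.1 - ((1 - b) • p + b • q).1 = (-b) • (q.1 - p.1) := by
    rw [Prod.fst_add, Prod.smul_fst, Prod.smul_fst, sub_smul, one_smul, neg_smul, smul_sub]; abel
  have e12 : p.2 - ((1 - b) • p + b • q).2 = (-b) • (q.2 - p.2) := by
    rw [Prod.snd_add, Prod.smul_snd, Prod.smul_snd, sub_smul, one_smul, neg_smul, smul_sub]; abel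
  have e21 : q.1 - ((1 - b) • p + b • q).1 = (1 - b) • (q.1 - p.1) := by
    rw [Prod.fst_add, Prod.smul_fst, Prod.smul_fst, sub_smul, one_smul, sub_smul, one_smul, smul_sub]; abel
  have e22 : q.2 - ((1 - b) • p + b • q).2 = (1 - b) • (q.2 - p.2) := by
    rw [Prod.snd_add, Prod.smul_snd, Prod.smul_snd, sub_smul, one_smul, sub_smul, one_smul, smul_sub]; abel
  rw [e11, e12, inner_smul_right, inner_smul_right, hQ₁, hQ₂] at h1
  rw [e21, e22, inner_smul_right, inner_smul_right, hQ₁, hQ₂] at h2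
  have hsum := add_le_add (mul_le_mul_of_nonneg_left h1 ha) (mul_le_mul_of_nonneg_left h2 hb)
  have hdrop : 0 ≤ (1 - b) * b * Q₂ (q.2 - p.2) := mul_nonneg (mul_nonneg ha hb) (hQ₂0 _)
  linear_combination hsum + hdrop

end ProdForm

end Summit.QuantumFields.BalabanUV.T4Continuum.NE7b.ConvexityModulusTransport
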